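import Summits.QuantumAdvantage.QuantumAdvantage.Theorems.CertDialJ
import Summits.QuantumAdvantage.QuantumAdvantage.Theorems.CertDialM
import HarnessLib

/-!
# CertDial — part N (§14c–d): SLIT-LOCAL and ANTIPODAL-LOCAL maps are cluster-local — THE ANTIPODES LOSE AT WEIGHT 5

§14c.  A SLIT-LOCAL answer map (`IsSlitLocal r S z`) lets row `b` read the input only through the radius-`r` windows around the
positions `b + s`, `s ∈ S` (free position-dependent tables): `S = {0}` is §9's window-locality, `S = {0, n/2}` is ANTIPODAL locality
(§14d).  GEOMETRY (`slit_same_cluster`, `slit_odd_low`, `slit_odd_high`; shape `M = 2r+2`, block points `0, 1, 2r+2, 4r+3, 4r+4`): if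
`0 ∈ S`, the slits are pairwise `≥ 6r+5` apart around the cycle and `n ≥ 6r+6`, then a row reads block points of at most ONE cluster, an
odd row below `M` reads no RIGHT point and an odd row in `(M, 2M)` no LEFT point — so the map is cluster-local (`slitLocal_nineClusterLocal`)
and part M applies: ★★★ `slitLightLaw_five` — every such map loses an odd-class input of weight `≤ 5`.
§14d.  COROLLARIES.  (i) `localLightLaw_five`: every radius-`r` window-local map loses at weight `≤ 5` from `n ≥ 6r+6` on (the weight-3 law
of §9 needs `n ≥ 12r+8`).  (ii) ★★★ `antipodalLightLaw_five` / `antipodalLightFail_five`: for even `n ≥ 12r+10` every ANTIPODAL-`r`-LOCAL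
answer map / strategy (reading the windows around `b` and around the antipode `b + n/2`; NO degree hypothesis) loses an odd-class input
of weight `≤ 5` — whereas at weight `≤ 3` the antipodal-1-local strategies of §10–§12 are PERFECT in their residue classes of `n`.
(iii) `antipodes_lose_five`: in particular the XOR-antipode, the OR-antipode and every period-4 affine antipode `p4Anti t` lose at weight
5 for EVERY even `n ≥ 22` (§13b had found the block of five by hand for two of them in half the residues).  So on the structured side of
the dichotomy the weight dial of «local + antipode» tables reads exactly `3 < w* ≤ 5`; the generic weight-5/7 leaves (`PGlobalFail 2 2 w`)
are untouched.  Imports parts J and M.  Nothing here touches 27432.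
`lean check` on the tree closure: rc 0, no warnings, no placeholders; axioms standard (`propext`, `Classical.choice`, `Quot.sound`).
-/

set_option linter.dupNamespace false
set_option linter.style.longLine false

noncomputable section
open scoped Classical

namespace Summit.QuantumAdvantage.QuantumAdvantage.Theorems.CertDial
open Finset
open Literature.Computability.QuantumComplexity Literature.Computability.QuantumComplexity.RingHLF
open Summit.QuantumAdvantage.AdviceFreeQNC0
open Literature.Computability.MetaComplexity Literature.Computability.MetaComplexity.Smolensky
open Summit.QuantumAdvantage.AdviceFreeQNC0.LightConeWindowHard (window window_apply)
open Summit.QuantumAdvantage.AdviceFreeQNC0.RingSymmetry (shift shift_shift)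

variable {n : ℕ}

/-! ### §14c Slit-local answer maps are cluster-local -/

/-- `d` lies within cyclic distance `r` of `p` on `ℤ/n` (for `p, d < n`). -/
def InWin (n r p d : ℕ) : Prop := (d ≤ p + r ∧ p ≤ d + r) ∨ n + d ≤ p + r ∨ n + p ≤ d + r

/-- SLIT-LOCAL answer maps: row `b` reads the input only through the radius-`r` windows around the positions `b + s`, `s ∈ S`
(tables arbitrary and position-dependent). -/
def IsSlitLocal (r : ℕ) (S : Finset ℕ) (z : (Fin n → Bool) → Fin n → Bool) : Prop :=
  ∀ x x' : Fin n → Bool, ∀ b : Fin n, (∀ s ∈ S, window r x (shift n s b) = window r x' (shift n s b)) → z x b = z x' b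

/-- the value of a shifted position without `%`: `b + k` or `b + k - n` (`k < n`). -/
theorem val_shift_cases {k : ℕ} (hk : k < n) (b : Fin n) :
    ((shift n k b : Fin n) : ℕ) = (b : ℕ) + k ∨ ((shift n k b : Fin n) : ℕ) + n = (b : ℕ) + k := by
  have hb := b.isLt
  rw [val_shift]
  rcases Nat.lt_or_ge ((b : ℕ) + k) n with h | h
  · exact Or.inl (Nat.mod_eq_of_lt h)
  · right
    rw [show (b : ℕ) + k = ((b : ℕ) + k - n) + n from by omega, Nat.add_mod_right, Nat.mod_eq_of_lt (by omega)]

/-- a slit-local row answers alike two inputs that agree at every position within distance `r` of one of its slits. -/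
theorem slitLocal_reads {r : ℕ} {S : Finset ℕ} {z : (Fin n → Bool) → Fin n → Bool} (hz : IsSlitLocal r S z) (hr : r ≤ n) (b : Fin n)
    {x x' : Fin n → Bool} (h : ∀ d : Fin n, (∃ s ∈ S, InWin n r (shift n s b) d) → x d = x' d) : z x b = z x' b := by
  apply hz; intro s hs; funext d'
  have hd' := d'.isLt; have hp := (shift n s b).isLt
  rw [window_apply r hr, window_apply r hr]
  apply h
  refine ⟨s, hs, ?_⟩
  simp only [InWin]
  split_ifs <;> omega

/-- GEOMETRY OF THE SLITS (shape `M = 2r+2`: block points `0, 1, 2r+2, 4r+3, 4r+4`): if the slits are pairwise `≥ 6r+5` apart around the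
cycle and `n ≥ 6r+6`, two block points read by the same row lie in the same cluster. -/
theorem slit_same_cluster {r : ℕ} {S : Finset ℕ} (hS : ∀ s ∈ S, s < n)
    (hsep : ∀ s ∈ S, ∀ t ∈ S, s < t → 6 * r + 5 ≤ t - s ∧ t - s + (6 * r + 5) ≤ n) (hn : 6 * r + 6 ≤ n) (b : Fin n) {d₁ d₂ : Fin n}
    (h₁ : ∃ s ∈ S, InWin n r (shift n s b) d₁) (h₂ : ∃ s ∈ S, InWin n r (shift n s b) d₂)
    (hd₁ : (d₁ : ℕ) ≤ 1 ∨ (d₁ : ℕ) = 2 * r + 2 ∨ (d₁ : ℕ) = 4 * r + 3 ∨ (d₁ : ℕ) = 4 * r + 4)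
    (hd₂ : (d₂ : ℕ) ≤ 1 ∨ (d₂ : ℕ) = 2 * r + 2 ∨ (d₂ : ℕ) = 4 * r + 3 ∨ (d₂ : ℕ) = 4 * r + 4) :
    ((d₁ : ℕ) ≤ 1 ∧ (d₂ : ℕ) ≤ 1) ∨ ((d₁ : ℕ) = 2 * r + 2 ∧ (d₂ : ℕ) = 2 * r + 2) ∨ (4 * r + 3 ≤ (d₁ : ℕ) ∧ 4 * r + 3 ≤ (d₂ : ℕ)) := by
  obtain ⟨s, hs, hw₁⟩ := h₁
  obtain ⟨t, ht, hw₂⟩ := h₂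
  have hb := b.isLt; have e₁ := d₁.isLt; have e₂ := d₂.isLt
  have vs := val_shift_cases (hS s hs) b
  have vt := val_shift_cases (hS t ht) b
  unfold InWin at hw₁ hw₂
  rcases lt_trichotomy s t with hlt | rfl | hgt
  · have := hsep s hs t ht hlt; omega
  · omega
  · have := hsep t ht s hs hgt; omega

/-- … with `0 ∈ S`, an odd row below `M = 2r+2` reads no RIGHT-cluster point … -/
theorem slit_odd_low {r : ℕ} {S : Finset ℕ} (h0 : (0 : ℕ) ∈ S) (hS : ∀ s ∈ S, s < n)
    (hsep : ∀ s ∈ S, ∀ t ∈ S, s < t → 6 * r + 5 ≤ t - s ∧ t - s + (6 * r + 5) ≤ n) (hn : 6 * r + 6 ≤ n) (b : Fin n)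
    (hbo : (b : ℕ) % 2 = 1) (hbM : (b : ℕ) < 2 * r + 2) {d : Fin n} (hd : ∃ s ∈ S, InWin n r (shift n s b) d) :
    (d : ℕ) ≠ 4 * r + 3 ∧ (d : ℕ) ≠ 4 * r + 4 := by
  obtain ⟨s, hs, hw⟩ := hd
  have hb := b.isLt; have e := d.isLt
  have vs := val_shift_cases (hS s hs) b
  unfold InWin at hw
  rcases Nat.eq_zero_or_pos s with rfl | hpos
  · omega
  · have := hsep 0 h0 s hs hpos; omega

/-- … and an odd row in `(M, 2M)` reads no LEFT-cluster point. -/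
theorem slit_odd_high {r : ℕ} {S : Finset ℕ} (h0 : (0 : ℕ) ∈ S) (hS : ∀ s ∈ S, s < n)
    (hsep : ∀ s ∈ S, ∀ t ∈ S, s < t → 6 * r + 5 ≤ t - s ∧ t - s + (6 * r + 5) ≤ n) (hn : 6 * r + 6 ≤ n) (b : Fin n)
    (hbo : (b : ℕ) % 2 = 1) (hbM : 2 * r + 2 < (b : ℕ)) (hb2 : (b : ℕ) < 4 * r + 4) {d : Fin n} (hd : ∃ s ∈ S, InWin n r (shift n s b) d) :
    (d : ℕ) ≠ 0 ∧ (d : ℕ) ≠ 1 := by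
  obtain ⟨s, hs, hw⟩ := hd
  have hb := b.isLt; have e := d.isLt
  have vs := val_shift_cases (hS s hs) b
  unfold InWin at hw
  rcases Nat.eq_zero_or_pos s with rfl | hpos
  · omega
  · have := hsep 0 h0 s hs hpos; omega

/-- ★ SLIT-LOCAL ⇒ CLUSTER-LOCAL (shape `M = 2r+2`): `0 ∈ S`, slits `< n` and pairwise `≥ 6r+5` apart around the cycle, `n ≥ 6r+6`. -/
theorem slitLocal_nineClusterLocal {r : ℕ} {S : Finset ℕ} {z : (Fin n → Bool) → Fin n → Bool} (h0 : (0 : ℕ) ∈ S)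
    (hS : ∀ s ∈ S, s < n) (hsep : ∀ s ∈ S, ∀ t ∈ S, s < t → 6 * r + 5 ≤ t - s ∧ t - s + (6 * r + 5) ≤ n) (hn : 6 * r + 6 ≤ n)
    (hz : IsSlitLocal r S z) : NineClusterLocal (2 * r + 2) z := by
  intro b
  have hb := b.isLt
  have hread : ∀ x x' : Fin n → Bool, (∀ d : Fin n, (∃ s ∈ S, InWin n r (shift n s b) d) → x d = x' d) → z x b = z x' b :=
    fun x x' h => slitLocal_reads hz (by omega) b h
  by_cases hL : ∃ d : Fin n, (∃ s ∈ S, InWin n r (shift n s b) d) ∧ (d : ℕ) ≤ 1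
  · -- the row reads a LEFT point: then no MIDDLE / RIGHT point, and it is not an odd row in `(M, 2M)`
    obtain ⟨d₁, hR₁, hd₁⟩ := hL
    refine Or.inr (Or.inl ⟨seesLeft_of_reads (M := 2 * r + 2) (by omega) hread fun d hd => ?_, fun hbo hMb => ?_⟩)
    · have key := fun (hbd : (d : ℕ) ≤ 1 ∨ (d : ℕ) = 2 * r + 2 ∨ (d : ℕ) = 4 * r + 3 ∨ (d : ℕ) = 4 * r + 4) =>
        slit_same_cluster hS hsep hn b hR₁ hd (Or.inl hd₁) hbd
      refine ⟨fun h => ?_, fun h => ?_, fun h => ?_⟩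
      · have := key (Or.inr (Or.inl h)); omega
      · have := key (Or.inr (Or.inr (Or.inl (by omega)))); omega
      · have := key (Or.inr (Or.inr (Or.inr (by omega)))); omega
    · by_contra hlt
      have := slit_odd_high h0 hS hsep hn b hbo (by omega) (by omega) hR₁
      omega
  by_cases hRt : ∃ d : Fin n, (∃ s ∈ S, InWin n r (shift n s b) d) ∧ 4 * r + 3 ≤ (d : ℕ) ∧ (d : ℕ) ≤ 4 * r + 4
  · -- the row reads a RIGHT point (and no LEFT point): then no MIDDLE point, and it is not an odd row below `M`
    obtain ⟨d₁, hR₁, hd₁, hd₁'⟩ := hRt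
    refine Or.inr (Or.inr ⟨seesRight_of_reads (M := 2 * r + 2) (by omega) hread fun d hd => ?_, fun hbo => ?_⟩)
    · have key := fun (hbd : (d : ℕ) ≤ 1 ∨ (d : ℕ) = 2 * r + 2 ∨ (d : ℕ) = 4 * r + 3 ∨ (d : ℕ) = 4 * r + 4) =>
        slit_same_cluster hS hsep hn b hR₁ hd (by omega) hbd
      refine ⟨fun h => ?_, fun h => ?_, fun h => ?_⟩
      · have := key (Or.inl (by omega)); omega
      · have := key (Or.inl (by omega)); omega
      · have := key (Or.inr (Or.inl h)); omega
    · by_contra hlt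
      have := slit_odd_low h0 hS hsep hn b hbo (by omega) hR₁
      omega
  · -- the row reads neither a LEFT nor a RIGHT point: it sees the nine through the MIDDLE cluster
    exact Or.inl (seesMid_of_reads (M := 2 * r + 2) (by omega) hread fun d hd =>
      ⟨fun h => hL ⟨d, hd, by omega⟩, fun h => hL ⟨d, hd, by omega⟩, fun h => hRt ⟨d, hd, by omega, by omega⟩,
        fun h => hRt ⟨d, hd, by omega, by omega⟩⟩)

/-- ★★★ THE SLIT-LOCAL LIGHT LAW at weight 5: for even `n ≥ 6r+6`, every slit-local answer map with `0 ∈ S` and slits pairwise `≥ 6r+5`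
apart loses an odd-class input of weight `≤ 5` (one of the nine lights of shape `2r+2`). -/
theorem slitLightLaw_five (r : ℕ) (he : n % 2 = 0) {S : Finset ℕ} (h0 : (0 : ℕ) ∈ S) (hS : ∀ s ∈ S, s < n)
    (hsep : ∀ s ∈ S, ∀ t ∈ S, s < t → 6 * r + 5 ≤ t - s ∧ t - s + (6 * r + 5) ≤ n) (hn : 6 * r + 6 ≤ n)
    (z : (Fin n → Bool) → Fin n → Bool) (hz : IsSlitLocal r S z) : ∃ x : Fin n → Bool, OddZeros x ∧ LightDial.wt x ≤ 5 ∧ ¬ Rel x (z x) :=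
  clusterLightLaw_five he (M := 2 * r + 2) (by omega) (by omega) (by omega) z (slitLocal_nineClusterLocal h0 hS hsep hn hz)

/-! ### §14d Window-local and antipodal-local maps; the antipodes of §10–§12 lose at weight 5 -/

/-- `shift n 0` is the identity. -/
theorem shift_zero_eq (b : Fin n) : shift n 0 b = b := Fin.ext (by rw [val_shift, Nat.add_zero, Nat.mod_eq_of_lt b.isLt])

/-- window-local maps (§9) are slit-local with the single slit `0` … -/
theorem isSlitLocal_of_windowLocal {r : ℕ} {z : (Fin n → Bool) → Fin n → Bool} (hz : IsWindowLocal r z) :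
    IsSlitLocal r ({0} : Finset ℕ) z := by
  intro x x' b h
  have h0 := h 0 (Finset.mem_singleton_self 0)
  rw [shift_zero_eq] at h0
  exact hz x x' b h0

/-- … so ★ THE LOCAL LIGHT LAW at weight 5 holds from `n ≥ 6r+6` on (the weight-3 law `localLightLaw_three` needs `n ≥ 12r+8`). -/
theorem localLightLaw_five (r : ℕ) (he : n % 2 = 0) (hn : 6 * r + 6 ≤ n) (z : (Fin n → Bool) → Fin n → Bool) (hz : IsWindowLocal r z) :
    ∃ x : Fin n → Bool, OddZeros x ∧ LightDial.wt x ≤ 5 ∧ ¬ Rel x (z x) :=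
  slitLightLaw_five r he (Finset.mem_singleton_self 0) (fun s hs => by rw [Finset.mem_singleton] at hs; omega)
    (fun s hs t ht hst => by rw [Finset.mem_singleton] at hs ht; omega) hn z (isSlitLocal_of_windowLocal hz)

/-- ANTIPODAL-`r`-LOCAL answer maps: row `b` reads the radius-`r` windows around `b` and around the antipode `b + n/2` (free
position-dependent tables). -/
def IsAntipodalLocal (r : ℕ) (z : (Fin n → Bool) → Fin n → Bool) : Prop :=
  ∀ x x' : Fin n → Bool, ∀ b : Fin n, window r x b = window r x' b →
    window r x (shift n (n / 2) b) = window r x' (shift n (n / 2) b) → z x b = z x' b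

/-- antipodal-local maps are slit-local with slits `{0, n/2}`. -/
theorem isSlitLocal_of_antipodalLocal {r : ℕ} {z : (Fin n → Bool) → Fin n → Bool} (hz : IsAntipodalLocal r z) :
    IsSlitLocal r ({0, n / 2} : Finset ℕ) z := by
  intro x x' b h
  have h0 := h 0 (by simp)
  have h1 := h (n / 2) (by simp)
  rw [shift_zero_eq] at h0
  exact hz x x' b h0 h1

/-- ★★★ THE ANTIPODAL LIGHT LAW at weight 5: for even `n ≥ 12r + 10`, every antipodal-`r`-local answer map loses an odd-class input of
weight `≤ 5`.  (At weight `≤ 3` this fails for `r = 1`: §10–§12.) -/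
theorem antipodalLightLaw_five (r : ℕ) (he : n % 2 = 0) (hn : 12 * r + 10 ≤ n) (z : (Fin n → Bool) → Fin n → Bool)
    (hz : IsAntipodalLocal r z) : ∃ x : Fin n → Bool, OddZeros x ∧ LightDial.wt x ≤ 5 ∧ ¬ Rel x (z x) :=
  slitLightLaw_five r he (S := ({0, n / 2} : Finset ℕ)) (by simp)
    (fun s hs => by simp only [Finset.mem_insert, Finset.mem_singleton] at hs; omega)
    (fun s hs t ht hst => by simp only [Finset.mem_insert, Finset.mem_singleton] at hs ht; omega) (by omega) z
    (isSlitLocal_of_antipodalLocal hz)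

/-- antipodal-local STRATEGIES in the lineage's language (no degree hypothesis). -/
def IsAntipodalLocalStrat (r : ℕ) (P : Fin n → CubeFn (ZMod 3) n) : Prop :=
  ∀ x x' : Fin n → Bool, ∀ b : Fin n, window r x b = window r x' b →
    window r x (shift n (n / 2) b) = window r x' (shift n (n / 2) b) → P b x = P b x'

/-- the answer map of an antipodal-local strategy is antipodal-local. -/
theorem isAntipodalLocal_ans {r : ℕ} {P : Fin n → CubeFn (ZMod 3) n} (hP : IsAntipodalLocalStrat r P) : IsAntipodalLocal r (ans P) :=
  fun x x' b h h' => by simp only [ans, hP x x' b h h']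

/-- ★★★ ANTIPODAL LIGHT FAIL at weight 5 (the antipodal sub-leaf of the generic weight-5 leaf, discharged with NO degree bound): for even
`n ≥ 12r + 10` every antipodal-`r`-local strategy loses an odd-class input of weight `≤ 5`. -/
theorem antipodalLightFail_five (r : ℕ) (he : n % 2 = 0) (hn : 12 * r + 10 ≤ n) (P : Fin n → CubeFn (ZMod 3) n)
    (hP : IsAntipodalLocalStrat r P) : ∃ x : Fin n → Bool, OddZeros x ∧ LightDial.wt x ≤ 5 ∧ ¬ Rel x (ans P x) :=
  antipodalLightLaw_five r he hn (ans P) (isAntipodalLocal_ans hP)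

/-- position `2` of a radius-`1` window is the successor. -/
theorem window_one_succ (hn : 2 ≤ n) (x : Fin n → Bool) (i : Fin n) : window 1 x i ⟨2, by omega⟩ = x (shift n 1 i) := by
  rw [window_apply 1 (by omega)]
  congr 1; apply Fin.ext
  have hi := i.isLt
  have hs := val_shift_cases (k := 1) (by omega) i
  have hs' := (shift n 1 i).isLt
  dsimp only
  split_ifs <;> omega

/-- the XOR-antipode (§10) is antipodal-1-local … -/
theorem xorAnti_antipodalLocal (hn : 3 ≤ n) : IsAntipodalLocal 1 (ans (xorAnti n)) := by
  intro x x' b hw ha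
  have h1 := congrFun hw ⟨2, by omega⟩
  have h2 := congrFun ha ⟨1, by omega⟩
  rw [window_one_succ (by omega), window_one_succ (by omega)] at h1
  rw [ParityDial.window_centre 1 (by omega), ParityDial.window_centre 1 (by omega)] at h2
  simp only [ans_xorAnti, h1, h2]

/-- … so is the OR-antipode (§11) … -/
theorem orAnti_antipodalLocal (hn : 3 ≤ n) : IsAntipodalLocal 1 (ans (orAnti n)) := by
  intro x x' b hw ha
  have h1 := congrFun hw ⟨2, by omega⟩
  have h2 := congrFun ha ⟨2, by omega⟩
  rw [window_one_succ (by omega), window_one_succ (by omega)] at h1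
  rw [window_one_succ (by omega), window_one_succ (by omega), shift_shift, show n / 2 + 1 = 1 + n / 2 from Nat.add_comm _ _] at h2
  simp only [ans_orAnti, h1, h2]

/-- … and every period-4 affine antipode (§12). -/
theorem p4Anti_antipodalLocal (t : ℕ) (hn : 3 ≤ n) : IsAntipodalLocal 1 (ans (p4Anti t n)) := by
  intro x x' b hw ha
  have h0 := congrFun hw ⟨1, by omega⟩
  have h1 := congrFun hw ⟨2, by omega⟩
  have h2 := congrFun ha ⟨2, by omega⟩
  rw [ParityDial.window_centre 1 (by omega), ParityDial.window_centre 1 (by omega)] at h0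
  rw [window_one_succ (by omega), window_one_succ (by omega)] at h1
  rw [window_one_succ (by omega), window_one_succ (by omega), shift_shift, show n / 2 + 1 = 1 + n / 2 from Nat.add_comm _ _] at h2
  simp only [ans_p4Anti, h0, h1, h2]

/-- ★★★ THE ANTIPODES LOSE AT WEIGHT 5: for every even `n ≥ 22` the XOR-antipode (§10), the OR-antipode (§11) and every period-4 affine
antipode `p4Anti t` (§12) — each perfect on the odd class at weight `≤ 3` in its residue classes of `n` — lose an odd-class input of
weight `≤ 5`. -/
theorem antipodes_lose_five (he : n % 2 = 0) (hn : 22 ≤ n) :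
    (∃ x : Fin n → Bool, OddZeros x ∧ LightDial.wt x ≤ 5 ∧ ¬ Rel x (ans (xorAnti n) x)) ∧
    (∃ x : Fin n → Bool, OddZeros x ∧ LightDial.wt x ≤ 5 ∧ ¬ Rel x (ans (orAnti n) x)) ∧
    ∀ t : ℕ, ∃ x : Fin n → Bool, OddZeros x ∧ LightDial.wt x ≤ 5 ∧ ¬ Rel x (ans (p4Anti t n) x) :=
  ⟨antipodalLightLaw_five 1 he (by omega) _ (xorAnti_antipodalLocal (by omega)),
   antipodalLightLaw_five 1 he (by omega) _ (orAnti_antipodalLocal (by omega)),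
   fun t => antipodalLightLaw_five 1 he (by omega) _ (p4Anti_antipodalLocal t (by omega))⟩

/-! ### Axiom audit -/

/-- info: 'Summit.QuantumAdvantage.QuantumAdvantage.Theorems.CertDial.slitLightLaw_five' depends on axioms: [propext,
 Classical.choice,
 Quot.sound] -/
#guard_msgs in #print axioms slitLightLaw_five

/-- info: 'Summit.QuantumAdvantage.QuantumAdvantage.Theorems.CertDial.antipodalLightFail_five' depends on axioms: [propext,
 Classical.choice,
 Quot.sound] -/
#guard_msgs in #print axioms antipodalLightFail_five

/-- info: 'Summit.QuantumAdvantage.QuantumAdvantage.Theorems.CertDial.antipodes_lose_five' depends on axioms: [propext,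
 Classical.choice,
 Quot.sound] -/
#guard_msgs in #print axioms antipodes_lose_five

end Summit.QuantumAdvantage.QuantumAdvantage.Theorems.CertDial
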